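import Mathlib
import Literature.Analysis.PDE.KernelTransferFamilies
import HarnessLib

/-!
# Kernel transfer, step 1: the six error families and their `L²` bounds

Analysis support file (everything proved, no definitions). Let `E_0,…,E_ℓ` be `C²` functions with
`|E_j − c_jι^{ℓ−j}| ≤ K x^{j−ℓ−1/2}`, `|(E_j − c_jι^{ℓ−j})'| ≤ K x^{j−ℓ−3/2}` on `[x₁,∞)` (`x₁ ≥ 1`,
`ι` smooth with `ι = 1/x` on `[½,∞)`, `c_j = ∏_{i<ℓ}(j−2i−1)`). For coefficient sequences `a, b`
the differences between the Cauchy data of the true kernel element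
`Σ_k (a_k/c_{2k}) P_{2k} + Σ_k (b_k/((2k+1)c_{2k})) P_{2k+1}` (`P_m = Σ_i binom(m,i) E_{m−i} tⁱ`) and
of its exact shadow `(Σ_k a_k ι^{ℓ−2k}, Σ_k b_k ι^{ℓ−2k})` split into six families

  `uVA_k = (a_k/c_{2k})(2k)E_{2k−1}`, `uVB_k = (b_k/c_{2k})(E_{2k} − c_{2k}ι^{ℓ−2k})`,
  `dPA_k = (a_k/c_{2k})(E_{2k} − c_{2k}ι^{ℓ−2k})'`, `dPB_k = (b_k/((2k+1)c_{2k})) E_{2k+1}'`,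
  `ι·uPA_k = ι(a_k/c_{2k})(E_{2k} − c_{2k}ι^{ℓ−2k})`, `ι·uPB_k = ι(b_k/((2k+1)c_{2k})) E_{2k+1}`,

each continuous and power-bounded (`c_{2k±1} = 0` makes `E_{2k±1}` pure error), whence
(`kernelTransfer_family_bounds`, via `family_sq_integral_le`) for `ρ ≥ x₁`

  `∫_{x>ρ} (Σ_k uVA_k)² , ∫ (Σ_k dPA_k)², ∫ (Σ_k ι uPA_k)² ≤ (ℓ+1) K²(2ℓ+1)² C ρ⁻¹ Σ_k a_k² ρ^{4k−2ℓ−1}`,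
  `∫_{x>ρ} (Σ_k uVB_k)² , ∫ (Σ_k dPB_k)², ∫ (Σ_k ι uPB_k)² ≤ (ℓ+1) K²(2ℓ+1)² C ρ⁻¹ Σ_k b_k² ρ^{4k−2ℓ+1}`,

`C = Σ_k c_{2k}⁻²`. Route PhotonSphereChannels, `FixedModeChannels`, far side
(stmt-FinalStateConjecture-10048). Folklore.
-/

noncomputable section

namespace Literature.Analysis.PDE

open MeasureTheory Set Filter Topology Finset

variable {ι : ℝ → ℝ} {E : ℕ → ℝ → ℝ} {ℓ : ℕ} {x₁ K : ℝ}

/-- **The six error families of the kernel transfer: continuity and `L²` bounds.** [folklore] -/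
theorem kernelTransfer_family_bounds (hι : ContDiff ℝ (⊤ : ℕ∞) ι)
    (hιeq : ∀ x : ℝ, 1 / 2 ≤ x → ι x = x⁻¹) (hx₁ : 1 ≤ x₁)
    (hEC : ∀ j, j ≤ ℓ → ContDiff ℝ 2 (E j))
    (hEb : ∀ j, j ≤ ℓ → ∀ x, x₁ ≤ x →
      |E j x - (∏ i ∈ range ℓ, ((j : ℝ) - 2 * i - 1)) * ι x ^ (ℓ - j)| ≤ K * x ^ ((j : ℝ) - ℓ - 1 / 2) ∧
      |deriv (E j) x - deriv (fun y => (∏ i ∈ range ℓ, ((j : ℝ) - 2 * i - 1)) * ι y ^ (ℓ - j)) x|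
        ≤ K * x ^ ((j : ℝ) - ℓ - 3 / 2))
    (a b : ℕ → ℝ) {ρ : ℝ} (hρ : x₁ ≤ ρ) (cE : ℕ → ℝ)
    (hcE : ∀ k, cE k = ∏ i ∈ range ℓ, (((2 * k : ℕ) : ℝ) - 2 * i - 1))
    (uVA uVB uPA uPB dPA dPB : ℕ → ℝ → ℝ)
    (huVA : ∀ k z, uVA k z = a k / cE k * ((2 * k : ℕ) : ℝ) * E (2 * k - 1) z)
    (huVB : ∀ k z, uVB k z = b k / cE k * (E (2 * k) z - cE k * ι z ^ (ℓ - 2 * k)))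
    (huPA : ∀ k z, uPA k z = a k / cE k * (E (2 * k) z - cE k * ι z ^ (ℓ - 2 * k)))
    (huPB : ∀ k z, uPB k z = b k / (((2 * k + 1 : ℕ) : ℝ) * cE k) * E (2 * k + 1) z)
    (hdPA : ∀ k z, dPA k z
      = a k / cE k * (deriv (E (2 * k)) z - deriv (fun y => cE k * ι y ^ (ℓ - 2 * k)) z))
    (hdPB : ∀ k z, dPB k z = b k / (((2 * k + 1 : ℕ) : ℝ) * cE k) * deriv (E (2 * k + 1)) z) :
    let TA : ℝ := ((ℓ : ℝ) + 1) * (K ^ 2 * (2 * (ℓ : ℝ) + 1) ^ 2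
        * (∑ k ∈ range (ℓ / 2 + 1), ((cE k) ^ 2)⁻¹) * ρ⁻¹
        * ∑ k ∈ range (ℓ / 2 + 1), a k ^ 2 * ρ ^ (4 * (k : ℝ) - 2 * ℓ - 1))
    let TB : ℝ := ((ℓ : ℝ) + 1) * (K ^ 2 * (2 * (ℓ : ℝ) + 1) ^ 2
        * (∑ k ∈ range (ℓ / 2 + 1), ((cE k) ^ 2)⁻¹) * ρ⁻¹
        * ∑ k ∈ range ((ℓ + 1) / 2), b k ^ 2 * ρ ^ (4 * (k : ℝ) - 2 * ℓ + 1))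
    ((∀ k ∈ range (ℓ / 2 + 1), Continuous (uVA k)) ∧
        (∀ k ∈ range ((ℓ + 1) / 2), Continuous (uVB k)) ∧
        (∀ k ∈ range (ℓ / 2 + 1), Continuous (uPA k)) ∧
        (∀ k ∈ range ((ℓ + 1) / 2), Continuous (uPB k)) ∧
        (∀ k ∈ range (ℓ / 2 + 1), Continuous (dPA k)) ∧
        (∀ k ∈ range ((ℓ + 1) / 2), Continuous (dPB k))) ∧
      (IntegrableOn (fun z => (∑ k ∈ range (ℓ / 2 + 1), uVA k z) ^ 2) (Ioi ρ) ∧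
        ∫ z in Ioi ρ, (∑ k ∈ range (ℓ / 2 + 1), uVA k z) ^ 2 ≤ TA) ∧
      (IntegrableOn (fun z => (∑ k ∈ range ((ℓ + 1) / 2), uVB k z) ^ 2) (Ioi ρ) ∧
        ∫ z in Ioi ρ, (∑ k ∈ range ((ℓ + 1) / 2), uVB k z) ^ 2 ≤ TB) ∧
      (IntegrableOn (fun z => (∑ k ∈ range (ℓ / 2 + 1), dPA k z) ^ 2) (Ioi ρ) ∧
        ∫ z in Ioi ρ, (∑ k ∈ range (ℓ / 2 + 1), dPA k z) ^ 2 ≤ TA) ∧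
      (IntegrableOn (fun z => (∑ k ∈ range ((ℓ + 1) / 2), dPB k z) ^ 2) (Ioi ρ) ∧
        ∫ z in Ioi ρ, (∑ k ∈ range ((ℓ + 1) / 2), dPB k z) ^ 2 ≤ TB) ∧
      (IntegrableOn (fun z => (∑ k ∈ range (ℓ / 2 + 1), ι z * uPA k z) ^ 2) (Ioi ρ) ∧
        ∫ z in Ioi ρ, (∑ k ∈ range (ℓ / 2 + 1), ι z * uPA k z) ^ 2 ≤ TA) ∧
      (IntegrableOn (fun z => (∑ k ∈ range ((ℓ + 1) / 2), ι z * uPB k z) ^ 2) (Ioi ρ) ∧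
        ∫ z in Ioi ρ, (∑ k ∈ range ((ℓ + 1) / 2), ι z * uPB k z) ^ 2 ≤ TB) := by
  intro TA TB
  have hρ1 : 1 ≤ ρ := hx₁.trans hρ
  have hρ0 : 0 < ρ := lt_of_lt_of_le one_pos hρ1
  have hcE0 : ∀ k, cE k ≠ 0 := fun k => by rw [hcE]; exact towerCoeff_even_ne_zero ℓ k
  set Cinv : ℝ := ∑ k ∈ range (ℓ / 2 + 1), ((cE k) ^ 2)⁻¹ with hCinv
  have hCinv0 : 0 ≤ Cinv := Finset.sum_nonneg fun k _ => by positivity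
  have hCinvk : ∀ k, k < ℓ / 2 + 1 → ((cE k) ^ 2)⁻¹ ≤ Cinv := fun k hk =>
    Finset.single_le_sum (f := fun k => ((cE k) ^ 2)⁻¹) (fun k _ => by positivity) (mem_range.2 hk)
  -- index facts
  have hka : ∀ k, k ∈ range (ℓ / 2 + 1) → 2 * k ≤ ℓ := fun k hk => by
    have := mem_range.1 hk; omega
  have hkb : ∀ k, k ∈ range ((ℓ + 1) / 2) → 2 * k + 1 ≤ ℓ := fun k hk => by
    have := mem_range.1 hk; omega
  -- chain facts on `[ρ, ∞)`
  have hE2k : ∀ k, 2 * k ≤ ℓ → ∀ z, ρ ≤ z →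
      |E (2 * k) z - cE k * ι z ^ (ℓ - 2 * k)| ≤ K * z ^ (2 * (k : ℝ) - ℓ - 1 / 2) ∧
      |deriv (E (2 * k)) z - deriv (fun y => cE k * ι y ^ (ℓ - 2 * k)) z|
        ≤ K * z ^ (2 * (k : ℝ) - ℓ - 3 / 2) := by
    intro k hk z hz
    have h := hEb (2 * k) hk z (hρ.trans hz)
    have hc1 : (((2 * k : ℕ)) : ℝ) - ℓ - 1 / 2 = 2 * (k : ℝ) - ℓ - 1 / 2 := by push_cast; ring
    have hc2 : (((2 * k : ℕ)) : ℝ) - ℓ - 3 / 2 = 2 * (k : ℝ) - ℓ - 3 / 2 := by push_cast; ring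
    rw [hc1, hc2, ← hcE k] at h
    exact h
  have hE2k1 : ∀ k, 2 * k + 1 ≤ ℓ → ∀ z, ρ ≤ z →
      |E (2 * k + 1) z| ≤ K * z ^ (2 * (k : ℝ) - ℓ + 1 / 2) ∧
      |deriv (E (2 * k + 1)) z| ≤ K * z ^ (2 * (k : ℝ) - ℓ - 1 / 2) := by
    intro k hk z hz
    have h := hEb (2 * k + 1) hk z (hρ.trans hz)
    rw [towerCoeff_odd_eq_zero (show k < ℓ by omega)] at h
    have hcast : (((2 * k + 1 : ℕ)) : ℝ) = 2 * (k : ℝ) + 1 := by push_cast; ring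
    simp only [zero_mul, sub_zero, deriv_const, hcast] at h
    obtain ⟨h1, h2⟩ := h
    constructor
    · rw [show 2 * (k : ℝ) - ℓ + 1 / 2 = 2 * (k : ℝ) + 1 - ℓ - 1 / 2 by ring]; exact h1
    · rw [show 2 * (k : ℝ) - ℓ - 1 / 2 = 2 * (k : ℝ) + 1 - ℓ - 3 / 2 by ring]; exact h2
  have hEodd : ∀ k, 1 ≤ k → 2 * k ≤ ℓ → ∀ z, ρ ≤ z →
      |E (2 * k - 1) z| ≤ K * z ^ (2 * (k : ℝ) - ℓ - 3 / 2) := by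
    intro k hk1 hk z hz
    obtain ⟨k', rfl⟩ : ∃ k', k = k' + 1 := ⟨k - 1, by omega⟩
    have h := (hE2k1 k' (by omega) z hz).1
    rw [show 2 * (k' + 1) - 1 = 2 * k' + 1 by omega]
    rw [show 2 * ((k' + 1 : ℕ) : ℝ) - ℓ - 3 / 2 = 2 * (k' : ℝ) - ℓ + 1 / 2 by push_cast; ring]
    exact h
  have hιz : ∀ z, ρ ≤ z → ι z = z⁻¹ := fun z hz => hιeq z (by linarith only [hz, hρ1])
  -- continuity
  have hιc : ∀ n : ℕ, Continuous fun y => ι y ^ n := fun n => hι.continuous.pow n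
  have hEc : ∀ j, j ≤ ℓ → Continuous (E j) := fun j hj => (hEC j hj).continuous
  have hEdc : ∀ j, j ≤ ℓ → Continuous (deriv (E j)) := fun j hj =>
    (hEC j hj).continuous_deriv (by norm_num)
  have hιndc : ∀ (cc : ℝ) (n : ℕ), Continuous (deriv fun y => cc * ι y ^ n) := fun cc n =>
    ((contDiff_const.mul (hι.pow n)).of_le (by exact_mod_cast le_top) :
      ContDiff ℝ 1 _).continuous_deriv le_rfl
  have eVA : ∀ k, uVA k = fun z => a k / cE k * ((2 * k : ℕ) : ℝ) * E (2 * k - 1) z :=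
    fun k => funext (huVA k)
  have eVB : ∀ k, uVB k = fun z => b k / cE k * (E (2 * k) z - cE k * ι z ^ (ℓ - 2 * k)) :=
    fun k => funext (huVB k)
  have ePA : ∀ k, uPA k = fun z => a k / cE k * (E (2 * k) z - cE k * ι z ^ (ℓ - 2 * k)) :=
    fun k => funext (huPA k)
  have ePB : ∀ k, uPB k = fun z => b k / (((2 * k + 1 : ℕ) : ℝ) * cE k) * E (2 * k + 1) z :=
    fun k => funext (huPB k)
  have edA : ∀ k, dPA k = fun z =>
      a k / cE k * (deriv (E (2 * k)) z - deriv (fun y => cE k * ι y ^ (ℓ - 2 * k)) z) :=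
    fun k => funext (hdPA k)
  have edB : ∀ k, dPB k = fun z =>
      b k / (((2 * k + 1 : ℕ) : ℝ) * cE k) * deriv (E (2 * k + 1)) z :=
    fun k => funext (hdPB k)
  have cVA : ∀ k ∈ range (ℓ / 2 + 1), Continuous (uVA k) := fun k hk => by
    rw [eVA]; exact continuous_const.mul (hEc _ (by have := hka k hk; omega))
  have cVB : ∀ k ∈ range ((ℓ + 1) / 2), Continuous (uVB k) := fun k hk => by
    rw [eVB]
    exact continuous_const.mul ((hEc _ (by have := hkb k hk; omega)).sub
      (continuous_const.mul (hιc _)))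
  have cPA : ∀ k ∈ range (ℓ / 2 + 1), Continuous (uPA k) := fun k hk => by
    rw [ePA]; exact continuous_const.mul ((hEc _ (hka k hk)).sub (continuous_const.mul (hιc _)))
  have cPB : ∀ k ∈ range ((ℓ + 1) / 2), Continuous (uPB k) := fun k hk => by
    rw [ePB]; exact continuous_const.mul (hEc _ (hkb k hk))
  have cdA : ∀ k ∈ range (ℓ / 2 + 1), Continuous (dPA k) := fun k hk => by
    rw [edA]; exact continuous_const.mul ((hEdc _ (hka k hk)).sub (hιndc _ _))
  have cdB : ∀ k ∈ range ((ℓ + 1) / 2), Continuous (dPB k) := fun k hk => by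
    rw [edB]; exact continuous_const.mul (hEdc _ (hkb k hk))
  have cwA : ∀ k ∈ range (ℓ / 2 + 1), Continuous fun z => ι z * uPA k z := fun k hk =>
    hι.continuous.mul (cPA k hk)
  have cwB : ∀ k ∈ range ((ℓ + 1) / 2), Continuous fun z => ι z * uPB k z := fun k hk =>
    hι.continuous.mul (cPB k hk)
  -- pointwise bounds on `[ρ, ∞)`
  have bVA : ∀ k ∈ range (ℓ / 2 + 1), ∀ z, ρ ≤ z →
      |uVA k z| ≤ (|a k| * K * ((2 * k : ℕ) : ℝ) / |cE k|) * z ^ (2 * (k : ℝ) - ℓ - 3 / 2) := by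
    intro k hk z hz
    rw [huVA]
    rcases Nat.eq_zero_or_pos k with rfl | hk1
    · simp
    · rw [abs_mul, abs_mul, abs_div, Nat.abs_cast]
      have hE := hEodd k hk1 (hka k hk) z hz
      calc |a k| / |cE k| * ((2 * k : ℕ) : ℝ) * |E (2 * k - 1) z|
          ≤ |a k| / |cE k| * ((2 * k : ℕ) : ℝ) * (K * z ^ (2 * (k : ℝ) - ℓ - 3 / 2)) := by gcongr
        _ = _ := by ring
  have bVB : ∀ k ∈ range ((ℓ + 1) / 2), ∀ z, ρ ≤ z →
      |uVB k z| ≤ (|b k| * K * 1 / |cE k|) * z ^ (2 * (k : ℝ) - ℓ - 1 / 2) := by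
    intro k hk z hz
    rw [huVB, abs_mul, abs_div]
    have hE := (hE2k k (by have := hkb k hk; omega) z hz).1
    calc |b k| / |cE k| * |E (2 * k) z - cE k * ι z ^ (ℓ - 2 * k)|
        ≤ |b k| / |cE k| * (K * z ^ (2 * (k : ℝ) - ℓ - 1 / 2)) := by gcongr
      _ = _ := by ring
  have bPA : ∀ k ∈ range (ℓ / 2 + 1), ∀ z, ρ ≤ z →
      |dPA k z| ≤ (|a k| * K * 1 / |cE k|) * z ^ (2 * (k : ℝ) - ℓ - 3 / 2) := by
    intro k hk z hz
    rw [hdPA, abs_mul, abs_div]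
    have hE := (hE2k k (hka k hk) z hz).2
    calc |a k| / |cE k| * |deriv (E (2 * k)) z - deriv (fun y => cE k * ι y ^ (ℓ - 2 * k)) z|
        ≤ |a k| / |cE k| * (K * z ^ (2 * (k : ℝ) - ℓ - 3 / 2)) := by gcongr
      _ = _ := by ring
  have bPB : ∀ k ∈ range ((ℓ + 1) / 2), ∀ z, ρ ≤ z →
      |dPB k z| ≤ (|b k| * K * ((((2 * k + 1 : ℕ)) : ℝ))⁻¹ / |cE k|)
        * z ^ (2 * (k : ℝ) - ℓ - 1 / 2) := by
    intro k hk z hz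
    rw [hdPB, abs_mul, abs_div, abs_mul, Nat.abs_cast]
    have hE := (hE2k1 k (hkb k hk) z hz).2
    have h21 : (0 : ℝ) < ((2 * k + 1 : ℕ) : ℝ) := by positivity
    calc |b k| / ((((2 * k + 1 : ℕ)) : ℝ) * |cE k|) * |deriv (E (2 * k + 1)) z|
        ≤ |b k| / ((((2 * k + 1 : ℕ)) : ℝ) * |cE k|) * (K * z ^ (2 * (k : ℝ) - ℓ - 1 / 2)) := by
          gcongr
      _ = _ := by field_simp
  have bwA : ∀ k ∈ range (ℓ / 2 + 1), ∀ z, ρ ≤ z →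
      |ι z * uPA k z| ≤ (|a k| * K * 1 / |cE k|) * z ^ (2 * (k : ℝ) - ℓ - 3 / 2) := by
    intro k hk z hz
    have hz0 : 0 < z := lt_of_lt_of_le hρ0 hz
    have hιa : |ι z| = z⁻¹ := by rw [hιz z hz, abs_inv, abs_of_pos hz0]
    rw [huPA, abs_mul, abs_mul, abs_div, hιa]
    have hE := (hE2k k (hka k hk) z hz).1
    calc z⁻¹ * (|a k| / |cE k| * |E (2 * k) z - cE k * ι z ^ (ℓ - 2 * k)|)
        ≤ z⁻¹ * (|a k| / |cE k| * (K * z ^ (2 * (k : ℝ) - ℓ - 1 / 2))) := by gcongr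
      _ = _ := by
          rw [show 2 * (k : ℝ) - ℓ - 3 / 2 = (2 * (k : ℝ) - ℓ - 1 / 2) + (-1) by ring,
            Real.rpow_add hz0 (2 * (k : ℝ) - ℓ - 1 / 2) (-1), Real.rpow_neg_one]
          ring
  have bwB : ∀ k ∈ range ((ℓ + 1) / 2), ∀ z, ρ ≤ z →
      |ι z * uPB k z| ≤ (|b k| * K * ((((2 * k + 1 : ℕ)) : ℝ))⁻¹ / |cE k|)
        * z ^ (2 * (k : ℝ) - ℓ - 1 / 2) := by
    intro k hk z hz
    have hz0 : 0 < z := lt_of_lt_of_le hρ0 hz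
    have hιa : |ι z| = z⁻¹ := by rw [hιz z hz, abs_inv, abs_of_pos hz0]
    rw [huPB, abs_mul, abs_mul, abs_div, abs_mul, Nat.abs_cast, hιa]
    have hE := (hE2k1 k (hkb k hk) z hz).1
    have h21 : (0 : ℝ) < ((2 * k + 1 : ℕ) : ℝ) := by positivity
    calc z⁻¹ * (|b k| / ((((2 * k + 1 : ℕ)) : ℝ) * |cE k|) * |E (2 * k + 1) z|)
        ≤ z⁻¹ * (|b k| / ((((2 * k + 1 : ℕ)) : ℝ) * |cE k|)
            * (K * z ^ (2 * (k : ℝ) - ℓ + 1 / 2))) := by gcongr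
      _ = _ := by
          rw [show 2 * (k : ℝ) - ℓ - 1 / 2 = (2 * (k : ℝ) - ℓ + 1 / 2) + (-1) by ring,
            Real.rpow_add hz0 (2 * (k : ℝ) - ℓ + 1 / 2) (-1), Real.rpow_neg_one]
          field_simp
  -- exponents, multipliers, cardinalities
  have gA : ∀ k ∈ range (ℓ / 2 + 1), 2 * (k : ℝ) - ℓ - 3 / 2 ≤ -1 := fun k hk => by
    have : (2 * k : ℝ) ≤ ℓ := by exact_mod_cast hka k hk
    linarith only [this]
  have gB : ∀ k ∈ range ((ℓ + 1) / 2), 2 * (k : ℝ) - ℓ - 1 / 2 ≤ -1 := fun k hk => by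
    have : (2 * k + 1 : ℝ) ≤ ℓ := by exact_mod_cast hkb k hk
    linarith only [this]
  have heA : ∀ k ∈ range (ℓ / 2 + 1),
      2 * (2 * (k : ℝ) - ℓ - 3 / 2) + 1 = (4 * (k : ℝ) - 2 * ℓ - 1) - 1 := fun k _ => by ring
  have heB : ∀ k ∈ range ((ℓ + 1) / 2),
      2 * (2 * (k : ℝ) - ℓ - 1 / 2) + 1 = (4 * (k : ℝ) - 2 * ℓ + 1) - 1 := fun k _ => by ring
  have hmA1 : ∀ k ∈ range (ℓ / 2 + 1), |(((2 * k : ℕ)) : ℝ)| ≤ 2 * (ℓ : ℝ) + 1 := fun k hk => by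
    rw [Nat.abs_cast]
    exact_mod_cast (show 2 * k ≤ 2 * ℓ + 1 by have := hka k hk; omega)
  have hm1 : ∀ k : ℕ, |(1 : ℝ)| ≤ 2 * (ℓ : ℝ) + 1 := fun k => by
    rw [abs_one]; exact_mod_cast (show 1 ≤ 2 * ℓ + 1 by omega)
  have hmB : ∀ k : ℕ, |((((2 * k + 1 : ℕ)) : ℝ))⁻¹| ≤ 2 * (ℓ : ℝ) + 1 := fun k => by
    have h21 : (1 : ℝ) ≤ ((2 * k + 1 : ℕ) : ℝ) := by exact_mod_cast (show 1 ≤ 2 * k + 1 by omega)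
    rw [abs_inv, Nat.abs_cast]
    calc ((((2 * k + 1 : ℕ)) : ℝ))⁻¹ ≤ 1 := inv_le_one_of_one_le₀ h21
      _ ≤ _ := by exact_mod_cast (show 1 ≤ 2 * ℓ + 1 by omega)
  have hcA : ∀ k ∈ range (ℓ / 2 + 1), ((cE k) ^ 2)⁻¹ ≤ Cinv := fun k hk => hCinvk k (mem_range.1 hk)
  have hcB : ∀ k ∈ range ((ℓ + 1) / 2), ((cE k) ^ 2)⁻¹ ≤ Cinv := fun k hk =>
    hCinvk k (by have := mem_range.1 hk; omega)
  have hNA : (((range (ℓ / 2 + 1)).card : ℕ) : ℝ) ≤ (ℓ : ℝ) + 1 := by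
    rw [Finset.card_range]; exact_mod_cast (show ℓ / 2 + 1 ≤ ℓ + 1 by omega)
  have hNB : (((range ((ℓ + 1) / 2)).card : ℕ) : ℝ) ≤ (ℓ : ℝ) + 1 := by
    rw [Finset.card_range]; exact_mod_cast (show (ℓ + 1) / 2 ≤ ℓ + 1 by omega)
  -- the six families
  refine ⟨⟨cVA, cVB, cPA, cPB, cdA, cdB⟩,
    family_sq_integral_le cVA gA heA hρ1 bVA hmA1 hcA hCinv0 hNA,
    family_sq_integral_le cVB gB heB hρ1 bVB (fun k _ => hm1 k) hcB hCinv0 hNB,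
    family_sq_integral_le cdA gA heA hρ1 bPA (fun k _ => hm1 k) hcA hCinv0 hNA,
    family_sq_integral_le cdB gB heB hρ1 bPB (fun k _ => hmB k) hcB hCinv0 hNB,
    family_sq_integral_le (u := fun k z => ι z * uPA k z) cwA gA heA hρ1 bwA (fun k _ => hm1 k)
      hcA hCinv0 hNA,
    family_sq_integral_le (u := fun k z => ι z * uPB k z) cwB gB heB hρ1 bwB (fun k _ => hmB k)
      hcB hCinv0 hNB⟩

end Literature.Analysis.PDE
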